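import Summits.HodgeConjecture.HodgeConjecture.Theorems.TropicalWeilObstructionTropicalHodgeBoundGenericity

/-!
# Crux `TropicalHodgeBound` (stmt-HodgeConjecture-18480), stub 4 — part C1: the certificate checker
# (computable core on natural-number codes)

Route `TropicalWeilObstruction` of `HodgeConjecture`, registered line `birth`
(`Cruxes/TropicalHodgeBound/Lines/birth.lean`), stub `stub_rationalHodgeCoordinates`; ingredient (C),
the rank certificate for the integer linear system satisfied by the integer coordinates `y(I, J)`
(`I, J` increasing `4`-words of `Fin 8`) of a tropical `4`-cycle class at a Weil-generic period (one
equation per monomial of the eigenwave identity, file `…Genericity`): its solution space is spanned by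
the coordinates of `θ₄`, `Re w`, `Im w`.

The checker is a small Gaussian-elimination VERIFIER, run by the kernel (`decide`) on certificate data
(files `…CertData*`). Everything is coded by natural numbers (words `Fin 4 → Fin 8` by four octal
digits, `K'` by five, `J'` by three, unknowns `(I, J)` by `70 · rank I + rank J`), so that kernel
reduction only performs integer arithmetic on short lists:

* `eqTermsN` recomputes a coefficient equation — all terms `(m, c)` whose four free variables
  (`evN` = code of `entryVar`, `esN` = `entrySign`) have the prescribed sorted code list `κ` — by
  enumerating, row by row, the candidate columns (`rowCandsN`), and transports each term to the
  increasing representatives (`sort4`, `sgnN`, `rankL`);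
* facts `d · y_u = Σ c_v · y_v` live in a `70 × 70` table; `reduce` substitutes facts, `doStep` solves the
  reduced equation for the target unknown; `checkBlock` runs an independent block of steps and then
  verifies that every unknown the block determines resolves onto the three free coordinates
  `u = 0, 4, 14` with the coefficients of `(θ₄, Re w, Im w)` (`basisN`, Gaussian-integer minors of
  Zharkov's frame `Ω`) transported by the fixed integer matrix `Λ = [[1,0,0],[0,0,-1],[1,-1,0]]`.

Definitions only; the soundness theorems are in `…CheckerSound`, the data in `…CertData*`, the kernel
runs in `…CertRun*`.

References: [MikhalkinZharkov2014Eigenwave] G. Mikhalkin, I. Zharkov, LN UMI 15 (2014), Thm. 5.4;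
[Zharkov2020TropicalWeil] I. Zharkov, arXiv:2002.02347, §2.
-/

set_option linter.dupNamespace false

namespace Summit.HodgeConjecture.HodgeConjecture.Theorems.TropicalHodgeBound

namespace Chk

/-! ### Codes of indices, entries and words -/

/-- Octal digit `i` (from the left, `i < 5`) of a `5`-digit code (a word `Fin 5 → Fin 8`). [folklore] -/
def kd (k i : ℕ) : ℕ := (k / 8 ^ (4 - i)) % 8

/-- Octal digit `i` (`i < 3`) of a `3`-digit code (a word `Fin 3 → Fin 8`). [folklore] -/
def jd (j i : ℕ) : ℕ := (j / 8 ^ (2 - i)) % 8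

/-- Octal digit `i` (`i < 4`) of a `4`-digit code (a word `Fin 4 → Fin 8`). [folklore] -/
def wd (n i : ℕ) : ℕ := (n / 8 ^ (3 - i)) % 8

/-- `Fin.succAbove` on codes: skip the index `m`. [folklore] -/
def sA (m a : ℕ) : ℕ := if a < m then a else a + 1

/-- The function `{0,1,2,3} → ℕ` with the four given values. [folklore] -/
def fn4 (a b c d : ℕ) : ℕ → ℕ := fun i => if i = 0 then a else if i = 1 then b else if i = 2 then c else d

/-- `entrySign` on codes (`α, β < 8`). [cite: Zharkov2020TropicalWeil, §2] -/
def esN (α β : ℕ) : ℤ :=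
  if decide (α < 4) = decide (β < 4) then 1
  else if α % 4 < β % 4 then (if α < 4 then 1 else -1)
  else if β % 4 < α % 4 then (if α < 4 then -1 else 1)
  else 0

/-- `varCode ∘ entryIdx` on codes: the code `8 p₁ + p₂` of the free index of the entry `(α, β)`.
[cite: Zharkov2020TropicalWeil, §2] -/
def evN (α β : ℕ) : ℕ :=
  if decide (α < 4) = decide (β < 4) then 8 * min (α % 4) (β % 4) + max (α % 4) (β % 4)
  else if α % 4 < β % 4 then 8 * (α % 4) + (β % 4 + 4)
  else if β % 4 < α % 4 then 8 * (β % 4) + (α % 4 + 4)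
  else 0

/-- Insert into a sorted list of naturals. [folklore] -/
def ins (x : ℕ) : List ℕ → List ℕ
  | [] => [x]
  | y :: l => if x ≤ y then x :: y :: l else y :: ins x l

/-- Sort four naturals. [folklore] -/
def sort4 (a b c d : ℕ) : List ℕ := ins a (ins b (ins c [d]))

/-- The sorted list of the four variable codes of the term `(K, c)` (canonical form of its monomial).
[cite: Zharkov2020TropicalWeil, §2] -/
def keyN (K c : ℕ → ℕ) : List ℕ :=
  sort4 (evN (K 0) (c 0)) (evN (K 1) (c 1)) (evN (K 2) (c 2)) (evN (K 3) (c 3))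

/-- The product of the four entry signs of the term `(K, c)`. [cite: Zharkov2020TropicalWeil, §2] -/
def spN (K c : ℕ → ℕ) : ℤ := esN (K 0) (c 0) * esN (K 1) (c 1) * esN (K 2) (c 2) * esN (K 3) (c 3)

/-- The four values of a word are pairwise distinct. [folklore] -/
def inj4 (c : ℕ → ℕ) : Bool :=
  decide (c 0 ≠ c 1 ∧ c 0 ≠ c 2 ∧ c 0 ≠ c 3 ∧ c 1 ≠ c 2 ∧ c 1 ≠ c 3 ∧ c 2 ≠ c 3)

/-- Number of inversions of a word. [folklore] -/
def invN (c : ℕ → ℕ) : ℕ :=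
  (if c 1 < c 0 then 1 else 0) + (if c 2 < c 0 then 1 else 0) + (if c 3 < c 0 then 1 else 0) +
    (if c 2 < c 1 then 1 else 0) + (if c 3 < c 1 then 1 else 0) + (if c 3 < c 2 then 1 else 0)

/-- Sign of the sorting permutation of a word with distinct values. [folklore] -/
def sgnN (c : ℕ → ℕ) : ℤ := if invN c % 2 = 0 then 1 else -1

/-- The sorted values of a word. [folklore] -/
def sortedL (c : ℕ → ℕ) : List ℕ := sort4 (c 0) (c 1) (c 2) (c 3)

/-- Lexicographic rank (`< 70`) of an increasing word `a < b < c < d` of `{0,…,7}`. [folklore] -/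
def rankL : List ℕ → ℕ
  | [a, b, c, d] =>
      ((List.range a).map fun x => Nat.choose (7 - x) 3).sum +
        (((List.range b).filter fun x => a < x).map fun x => Nat.choose (7 - x) 2).sum +
        (((List.range c).filter fun x => b < x).map fun x => 7 - x).sum + (d - c - 1)
  | _ => 0

/-- The code `70 · rank (sort c) + rank (sort d)` of the unknown `y(sort c, sort d)`. [folklore] -/
def unkN (c d : ℕ → ℕ) : ℕ := 70 * rankL (sortedL c) + rankL (sortedL d)

/-! ### Equations -/

/-- Candidate columns for row `j` of a term with sorted key `κ`: non-zero entries of row `K j` whose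
variable code occurs in `κ`. [folklore] -/
def rowCandsN (K : ℕ → ℕ) (κ : List ℕ) (j : ℕ) : List ℕ :=
  (List.range 8).filter fun β => decide (esN (K j) β ≠ 0 ∧ evN (K j) β ∈ κ)

/-- The `m`-th part of the coefficient equation of `(K', J')` (codes `k5`, `j3`) at the key `κ`,
transported to increasing words: terms `(unknown, coefficient)`. [cite: Zharkov2020TropicalWeil, §2] -/
def eqTermsM (k5 j3 : ℕ) (κ : List ℕ) (m : ℕ) : List (ℕ × ℤ) :=
  let K : ℕ → ℕ := fun a => kd k5 (sA m a)
  let d : ℕ → ℕ := fn4 (kd k5 m) (jd j3 0) (jd j3 1) (jd j3 2)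
  (rowCandsN K κ 0).flatMap fun a => (rowCandsN K κ 1).flatMap fun b =>
    (rowCandsN K κ 2).flatMap fun e => (rowCandsN K κ 3).filterMap fun f =>
      if keyN K (fn4 a b e f) = κ ∧ spN K (fn4 a b e f) ≠ 0 ∧ inj4 (fn4 a b e f) = true ∧ inj4 d = true then
        some (unkN (fn4 a b e f) d,
          (-1) ^ m * spN K (fn4 a b e f) * sgnN (fn4 a b e f) * sgnN d)
      else none

/-- The coefficient equation of `(K', J')` at the key `κ`: all five parts. [cite: Zharkov2020TropicalWeil, §2] -/
def eqTermsN (k5 j3 : ℕ) (κ : List ℕ) : List (ℕ × ℤ) :=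
  eqTermsM k5 j3 κ 0 ++ eqTermsM k5 j3 κ 1 ++ eqTermsM k5 j3 κ 2 ++ eqTermsM k5 j3 κ 3 ++ eqTermsM k5 j3 κ 4

/-! ### Integer linear combinations and the table of facts -/

/-- The total coefficient of the unknown `u` in a combination. [folklore] -/
def coefOf (l : List (ℕ × ℤ)) (u : ℕ) : ℤ := ((l.filter fun p => p.1 = u).map fun p => p.2).sum

/-- Remove the unknown `u` from a combination. [folklore] -/
def eraseKey (l : List (ℕ × ℤ)) (u : ℕ) : List (ℕ × ℤ) := l.filter fun p => p.1 ≠ u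

/-- Scale a combination. [folklore] -/
def scaleL (k : ℤ) (l : List (ℕ × ℤ)) : List (ℕ × ℤ) := l.map fun p => (p.1, k * p.2)

/-- Add one term, merging equal unknowns and dropping zeros. [folklore] -/
def addTerm : List (ℕ × ℤ) → ℕ × ℤ → List (ℕ × ℤ)
  | [], (u, c) => if c = 0 then [] else [(u, c)]
  | (v, a) :: l, (u, c) =>
      if v = u then (if a + c = 0 then l else (v, a + c) :: l) else (v, a) :: addTerm l (u, c)

/-- Merge two combinations. [folklore] -/
def mergeL (l₁ l₂ : List (ℕ × ℤ)) : List (ℕ × ℤ) := l₂.foldl addTerm l₁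

/-- A recorded fact `(d, l)` about an unknown `u` means `d · y_u = Σ_{(v,c) ∈ l} c · y_v`. -/
abbrev Fact := ℤ × List (ℕ × ℤ)

/-- The table of facts, `70 × 70`, indexed by the unknown code `70 i + j`. -/
abbrev Table := List (List (Option Fact))

/-- The empty table. [folklore] -/
def emptyTable : Table := List.replicate 70 (List.replicate 70 none)

/-- Look up the fact recorded for the unknown `u`. [folklore] -/
def Table.get (t : Table) (u : ℕ) : Option Fact := (t.getD (u / 70) []).getD (u % 70) none

/-- Record a fact for the unknown `u`. [folklore] -/
def Table.set (t : Table) (u : ℕ) (f : Fact) : Table :=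
  List.set t (u / 70) ((t.getD (u / 70) []).set (u % 70) (some f))

/-- The first unknown of a combination that has a recorded fact. [folklore] -/
def findFact (t : Table) : List (ℕ × ℤ) → Option (ℕ × Fact)
  | [] => none
  | (u, _) :: l => match t.get u with
    | some f => some (u, f)
    | none => findFact t l

/-- Substitute recorded facts into `(mult, row)` until no unknown of the row has a fact (or the fuel
runs out); the invariant is `mult · E = Σ row` for the quantity `E` being reduced. [folklore] -/
def reduce (t : Table) : ℕ → ℤ × List (ℕ × ℤ) → ℤ × List (ℕ × ℤ)
  | 0, x => x
  | n + 1, (mult, row) => match findFact t row with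
    | none => (mult, row)
    | some (u, (d, co)) =>
        reduce t n (mult * d, mergeL (scaleL d (eraseKey row u)) (scaleL (coefOf row u) co))

/-- One certificate step: reduce the equation, solve it for the target unknown `u`, record the fact.
Fails (`none`) if `u` does not occur in the reduced equation. [folklore] -/
def doStep (t : Table) (eq : List (ℕ × ℤ)) (u : ℕ) : Option Table :=
  let r := (reduce t 64 (1, mergeL [] eq)).2
  if coefOf r u = 0 then none else some (t.set u (coefOf r u, scaleL (-1) (eraseKey r u)))

/-! ### Decoding the certificate and running a block -/

/-- The unknown of a packed step `((((k5 · 512 + j3) · 5 + m₀) · 4096 + c₀) · 4900 + u`. [folklore] -/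
def stepTarget (n : ℕ) : ℕ := n % 4900

/-- Run one packed step: the equation of `(K', J')` (octal codes `k5`, `j3`) at the key of the
generating term `(m₀, c₀)`, solved for `u`. [folklore] -/
def runStep (t : Table) (n : ℕ) : Option Table :=
  let u := n % 4900
  let c₀ := (n / 4900) % 4096
  let m₀ := (n / 4900 / 4096) % 5
  let j3 := (n / 4900 / 4096 / 5) % 512
  let k5 := n / 4900 / 4096 / 5 / 512
  doStep t (eqTermsN k5 j3 (keyN (fun a => kd k5 (sA m₀ a)) (fun i => wd c₀ i))) u

/-- Run a list of packed steps. [folklore] -/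
def runSteps : Table → List ℕ → Option Table
  | t, [] => some t
  | t, n :: l => match runStep t n with
    | none => none
    | some t' => runSteps t' l

/-! ### The three classes at increasing word pairs and the final check -/

/-- The `70` increasing words, as sorted digit lists, in rank order. [folklore] -/
def sortedWords : List (List ℕ) :=
  (List.range 8).flatMap fun a => (List.range 8).flatMap fun b => (List.range 8).flatMap fun c =>
    (List.range 8).filterMap fun d => if a < b ∧ b < c ∧ c < d then some [a, b, c, d] else none

/-- Explicit `3 × 3` determinant over a commutative ring. [folklore] -/
def det3R {R : Type*} [CommRing R] (m : Fin 3 → Fin 3 → R) : R :=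
  m 0 0 * m 1 1 * m 2 2 - m 0 0 * m 1 2 * m 2 1 - m 0 1 * m 1 0 * m 2 2 + m 0 1 * m 1 2 * m 2 0 +
    m 0 2 * m 1 0 * m 2 1 - m 0 2 * m 1 1 * m 2 0

/-- Explicit `4 × 4` determinant over a commutative ring (Laplace along the first row). [folklore] -/
def det4R {R : Type*} [CommRing R] (M : Fin 4 → Fin 4 → R) : R :=
  M 0 0 * det3R (fun a b => M a.succ ((0 : Fin 4).succAbove b)) -
    M 0 1 * det3R (fun a b => M a.succ ((1 : Fin 4).succAbove b)) +
    M 0 2 * det3R (fun a b => M a.succ ((2 : Fin 4).succAbove b)) -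
    M 0 3 * det3R (fun a b => M a.succ ((3 : Fin 4).succAbove b))

/-- The entry `(α, b)` of Zharkov's frame `Ω` (`ω_b = e_b - i e_{b+4}`), on codes, as a Gaussian integer.
[cite: Zharkov2020TropicalWeil, §2] -/
def omegaN (α b : ℕ) : GaussianInt := if α = b then 1 else if α = b + 4 then ⟨0, -1⟩ else 0

/-- The Gaussian-integer minor `det Ω[I, ·]` of the rows listed in `I`. [cite: Zharkov2020TropicalWeil, §2] -/
def omegaMinorN (I : List ℕ) : GaussianInt :=
  det4R fun (a : Fin 4) (b : Fin 4) => omegaN (I.getD a 0) b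

/-- The integer values at the increasing word pair `(I, J)` (digit lists) of `θ₄` (`[I = J]`), `Re w`,
`Im w` (`w(I,J) = det Ω[I,·] det Ω[J,·]`). [cite: Zharkov2020TropicalWeil, §2] -/
def basisN (I J : List ℕ) : ℤ × ℤ × ℤ :=
  (if I = J then 1 else 0, (omegaMinorN I * omegaMinorN J).re, (omegaMinorN I * omegaMinorN J).im)

/-- The final check for one unknown `u = 70 i + j`: it resolves to `D · y_u = R₀ y₀ + R₁ y₄ + R₂ y₁₄`
over the three free unknowns `0, 4, 14`, with `D ≠ 0` and
`(R₀, R₁, R₂) = D · (B₀, -B₂, B₀ - B₁)` for `B = basisN` — i.e. `Λ = [[1,0,0],[0,0,-1],[1,-1,0]]`.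
[folklore] -/
def finalOne (t : Table) (u : ℕ) : Bool :=
  let DR := reduce t 64 (1, [(u, 1)])
  let B := basisN (sortedWords.getD (u / 70) []) (sortedWords.getD (u % 70) [])
  decide (DR.1 ≠ 0) && (DR.2.all fun q => decide (q.1 = 0 ∨ q.1 = 4 ∨ q.1 = 14)) &&
    decide (coefOf DR.2 0 = DR.1 * B.1) && decide (coefOf DR.2 4 = - (DR.1 * B.2.2)) &&
    decide (coefOf DR.2 14 = DR.1 * (B.1 - B.2.1))

/-- The table recording a given list of facts. [folklore] -/
def Table.ofFacts (l : List (ℕ × Fact)) : Table := l.foldl (fun t p => t.set p.1 p.2) emptyTable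

/-- Whether the table records each of the given facts verbatim. [folklore] -/
def Table.has (t : Table) (l : List (ℕ × Fact)) : Bool := l.all fun p => decide (t.get p.1 = some p.2)

/-- Check one CHUNK of the certificate: starting from the table of the (already certified) facts
`factsIn`, run the packed `steps`; then verify that the resulting table records the facts `factsOut`
verbatim (handed to the next chunk of the same component) and that every unknown in `finals` passes the
final check. [folklore] -/
def checkChunk (factsIn : List (ℕ × Fact)) (steps : List ℕ) (factsOut : List (ℕ × Fact))
    (finals : List ℕ) : Bool :=
  match runSteps (Table.ofFacts factsIn) steps with
  | none => false
  | some t => t.has factsOut && finals.all fun u => finalOne t u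

end Chk

end Summit.HodgeConjecture.HodgeConjecture.Theorems.TropicalHodgeBound
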